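import Summits.QuantumAdvantage.QuantumAdvantage.Theorems.LinnikCubicClassGroupsDegreeOnePrimesEscapeCubicEscapeLever
import Summits.QuantumAdvantage.QuantumAdvantage.Theorems.LinnikCubicClassGroupsDegreeOnePrimesEscapePerCharacterDeficitCounting
import Summits.QuantumAdvantage.QuantumAdvantage.Theorems.LinnikCubicClassGroupsDegreeOnePrimesEscapeStarkInexplicit
import Summits.QuantumAdvantage.QuantumAdvantage.Theorems.DegreeOnePrimesEscape.Negative.EscapeCounting
import Summits.QuantumAdvantage.QuantumAdvantage.Theorems.LinnikCubicClassGroupsDegreeOnePrimesEscapeComposition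
import Literature.NumberTheory.LFunctions.LogIntegralProofs
import HarnessLib

/-!
# The `n = 3` slice `CubicEscape` of the crux `DegreeOnePrimesEscape` from the per-field analytic
# inputs (per-character deficit, lower prime ideal theorem unless nearby zero, residue bound)

Topic `Summits/QuantumAdvantage/QuantumAdvantage/Theorems`, helper for the crux `DegreeOnePrimesEscape`
(stmt-QuantumAdvantage-11543) of route `LinnikCubicClassGroups`; cell B2b-1 (linnik-cubic), PART B.
HONEST FRAMING: the value of this file is a THEOREM (a kernel-checked composition) — not summit progress.

This is the per-field composition `escape_of_inputs` of the line `subgroup-orthogonality-escape`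
(skeleton `Cruxes/DegreeOnePrimesEscape/Lines/subgroup-orthogonality-escape.lean`, §4, second lead
2026-08-16), moved under `Theorems/` so that it can be IMPORTED, together with its specialisation to
degree `3` in the `κ`-form: given, uniformly over cubic fields `K` with `κ_K ≥ Q^{−A}` (`Q = |d_K|·27`),
the one-sided per-character deficit (T4) and the lower prime ideal theorem dichotomy (T5), and given
the residue lower bound `κ_K ≥ Q^{−A}` for all cubic `K` (R), the body of `DegreeOnePrimesEscape` at
`n = 3` holds (`cubicEscape_of_kappaInputs`); Stark's zero-free interval (S) is the tree's theorem
`stub_starkNoQuadSubfield 3`, the lever is `CubicEscape.index_mul_sum_filter_mem_le` (part 1).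

* §3 `escape_of_inputs` — verbatim the skeleton's per-field composition (any degree `n ≥ 3`);
* §4 `cubicEscape_of_kappaInputs` — the `n = 3` slice from T4(3), T5(3), R(3).
-/

noncomputable section


open scoped NumberField nonZeroDivisors
open Literature.NumberTheory.LFunctions Literature.NumberTheory.LFunctions.NumberField
open Summit.QuantumAdvantage.QuantumAdvantage.Theorems.DegreeOnePrimesEscape.Negative
  (escapeSet degOneInClass degOneInClass_finite degOneInClass_disjoint ncard_escapeSet_eq_sum)

namespace Summit.QuantumAdvantage.QuantumAdvantage.Theorems.DegreeOnePrimesEscape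

namespace CubicEscape

/-! ## §3 The per-field composition (any degree `n ≥ 3`) -/

set_option maxHeartbeats 800000 in
/-- **The crux inequality for ONE field from the three analytic inputs at that field** (the
composition of line `subgroup-orthogonality-escape`, verbatim): given, for `K` of degree `n ≥ 3`, the
per-character deficit at `x ≥ Q^{C₂}`, the lower PIT dichotomy at `x ≥ Q^{C₁}` and Stark's interval with
constant `c`, the escape inequality holds for `x ≥ |d_K|^{Cn}`, `Cn = (⌈max(C₂, C₁, 1, 4/c)⌉ + 50)(1 + n²) + n`.
For `x ≥ |d_K|^{Cn}` (`≥ Q^{C₂}, Q^{C₁}`, and `log x ≥ (4/c) log|d_K|`): the nearby-zero alternative is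
impossible (Stark: `β₁ < 1 − c/log|d_K|` forces `(1 − β₁) log x ≥ c·Cn ≥ 4`), so
`π_K(x) ≥ (29/32) Li(x)`; the lever (§1, `B = Li/8`) gives `m·#(deg-1 primes in M) ≤ π¹_K + (m − 1) Li/8`,
hence `#escape ≥ ½(π¹_K − Li/8)`; with `π¹_K ≥ π_K − n π(√x)` and Chebyshev
`π(x) ≤ 2 log 4 · x/log x + √x` the inequality `π(x) ≤ 8·#escape` follows. -/
theorem escape_of_inputs {n : ℕ} (hn3 : 3 ≤ n) {C₂ C₁ c : ℝ} (hc : 0 < c)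
    (K : Type) [Field K] [NumberField K] (hKn : Module.finrank ℚ K = n)
    (hC₂ : ∀ χ : ClassGroup (𝓞 K) →* ℂˣ, χ ≠ 1 → ∀ y : ℝ, ThornerZaman.condQn K ^ C₂ ≤ y →
      8 * ∑ C : ClassGroup (𝓞 K), ((χ C : ℂ)).re * (degOneClassCount K C y : ℝ) ≤ offsetLogIntegral y)
    (hC₁ : ∀ y : ℝ, ThornerZaman.condQn K ^ C₁ ≤ y →
      29 * offsetLogIntegral y ≤ 32 * (primeIdealCount K y : ℝ) ∨
      ∃ β₁ : ℝ, 1 - 1 / (8 * Real.log (ThornerZaman.condQn K)) < β₁ ∧ β₁ < 1 ∧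
        dedekindZetaCont K β₁ = 0 ∧ (1 - β₁) * Real.log y < 4)
    (hSc : ∀ σ : ℝ, 1 - c / Real.log ((NumberField.discr K).natAbs : ℝ) ≤ σ → σ < 1 →
      dedekindZetaCont K σ ≠ 0)
    (x : ℕ) (Cn : ℕ) (hCn : Cn = (⌈max (max C₂ C₁) (max 1 (4 / c))⌉₊ + 50) * (1 + n ^ 2) + n)
    (hx : |NumberField.discr K| ^ Cn ≤ (x : ℤ))
    (M : Subgroup (ClassGroup (𝓞 K))) (hM : M ≠ ⊤) :
    Nat.primeCounting x ≤ 8 * (escapeSet K x M).ncard := by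
  classical
  have h1n : 1 < n := by omega
  set C' : ℝ := max (max C₂ C₁) (max 1 (4 / c)) with hC'def
  have hK : 1 < Module.finrank ℚ K := by rw [hKn]; exact h1n
  set d : ℝ := |(NumberField.discr K : ℝ)| with hddef
  set Q : ℝ := ThornerZaman.condQn K with hQdef
  -- d ≥ 3, Q = d n^n ≤ d^(1+n²)
  have hd3 : (3:ℝ) ≤ d := by
    have h2 := NumberField.abs_discr_gt_two hK
    rw [hddef, ← Int.cast_abs]
    exact_mod_cast (show (3:ℤ) ≤ |NumberField.discr K| by omega)
  have hd1 : (1:ℝ) ≤ d := by linarith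
  have hdpos : (0:ℝ) < d := by linarith
  have hQ : Q = d * (n : ℝ) ^ n := by rw [hQdef, ThornerZaman.condQn, hKn]
  have hnn : (n : ℝ) ^ n ≤ d ^ (n ^ 2) := by
    have h1 : (n : ℝ) ≤ 3 ^ n := by
      exact_mod_cast (Nat.lt_pow_self (by norm_num : 1 < 3) (n := n)).le
    calc (n:ℝ) ^ n ≤ (3 ^ n) ^ n := pow_le_pow_left₀ (by positivity) h1 n
      _ = 3 ^ (n ^ 2) := by rw [← pow_mul]; ring_nf
      _ ≤ d ^ (n ^ 2) := pow_le_pow_left₀ (by norm_num) hd3 _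
  have hQle : Q ≤ d ^ (1 + n ^ 2) := by
    rw [hQ, pow_add, pow_one]
    exact mul_le_mul_of_nonneg_left hnn (by linarith)
  have hQ12 : 12 ≤ Q := ThornerZaman.twelve_le_condQn (K := K) hK
  have hQ1 : 1 ≤ Q := by linarith
  -- x ≥ d^Cn ≥ 3^Cn
  have hx_d : d ^ Cn ≤ (x : ℝ) := by
    have h1 : ((|NumberField.discr K| ^ Cn : ℤ) : ℝ) ≤ ((x : ℤ) : ℝ) := by exact_mod_cast hx
    rw [Int.cast_pow, Int.cast_abs, Int.cast_natCast] at h1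
    exact h1
  have hx_3 : (3:ℝ) ^ Cn ≤ (x : ℝ) := le_trans (pow_le_pow_left₀ (by norm_num) hd3 Cn) hx_d
  -- Q^{C'} ≤ x
  have hC'1 : 1 ≤ C' := le_trans (le_max_left _ _) (le_max_right _ _)
  have hC'0 : 0 ≤ C' := by linarith
  have hQC' : Q ^ C' ≤ (x : ℝ) := by
    have h1 : Q ^ C' ≤ Q ^ ((⌈C'⌉₊ + 50 : ℕ) : ℝ) := by
      apply Real.rpow_le_rpow_of_exponent_le hQ1
      have := Nat.le_ceil C'
      push_cast
      linarith
    rw [Real.rpow_natCast] at h1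
    calc Q ^ C' ≤ Q ^ (⌈C'⌉₊ + 50) := h1
      _ ≤ (d ^ (1 + n ^ 2)) ^ (⌈C'⌉₊ + 50) := pow_le_pow_left₀ (by linarith) hQle _
      _ = d ^ ((1 + n ^ 2) * (⌈C'⌉₊ + 50)) := by rw [← pow_mul]
      _ ≤ d ^ Cn := pow_le_pow_right₀ hd1 (by rw [hCn]; nlinarith)
      _ ≤ (x : ℝ) := hx_d
  have hC₂le : C₂ ≤ C' := le_trans (le_max_left _ _) (le_max_left _ _)
  have hC₁le : C₁ ≤ C' := le_trans (le_max_right _ _) (le_max_left _ _)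
  have hcle : 4 / c ≤ C' := le_trans (le_max_right _ _) (le_max_right _ _)
  have hQC₂ : Q ^ C₂ ≤ (x : ℝ) := le_trans (Real.rpow_le_rpow_of_exponent_le hQ1 hC₂le) hQC'
  have hQC₁ : Q ^ C₁ ≤ (x : ℝ) := le_trans (Real.rpow_le_rpow_of_exponent_le hQ1 hC₁le) hQC'
  -- sizes
  have hCn50 : 50 * (1 + n ^ 2) ≤ Cn := by rw [hCn]; nlinarith
  have hCnC' : C' ≤ (Cn : ℝ) := by
    have h1 : C' ≤ (⌈C'⌉₊ : ℝ) := Nat.le_ceil C'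
    have h2 : (⌈C'⌉₊ : ℕ) ≤ Cn := by rw [hCn]; nlinarith
    have h3 : ((⌈C'⌉₊ : ℕ) : ℝ) ≤ (Cn : ℝ) := by exact_mod_cast h2
    linarith
  have hxbig : (100 * ((n:ℝ) + 1)) ^ 4 ≤ (x : ℝ) := by
    have h1 : ((100 * (n + 1)) ^ 4 : ℕ) ≤ 3 ^ Cn := Dock.pow_bound n Cn hCn50
    have h2 : (((100 * (n + 1)) ^ 4 : ℕ) : ℝ) ≤ ((3 ^ Cn : ℕ) : ℝ) := by exact_mod_cast h1
    push_cast at h2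
    linarith
  have hsize := Dock.size_ineq n hxbig
  have hx3' : (3:ℝ) ≤ (x : ℝ) := by
    have : (3:ℝ) ^ 1 ≤ 3 ^ Cn := pow_le_pow_right₀ (by norm_num) (by omega)
    linarith
  have hxpos : 0 < (x : ℝ) := by linarith
  have hx1 : 1 < (x : ℝ) := by linarith
  have hx2 : 2 ≤ (x : ℝ) := by linarith
  have hlogx : 1 ≤ Real.log (x : ℝ) := by
    rw [Real.le_log_iff_exp_le hxpos]
    have := Real.exp_one_lt_d9
    linarith
  have hlogpos : 0 < Real.log (x : ℝ) := by linarith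
  -- log x ≥ Cn · log d
  have hlogd : 0 < Real.log d := Real.log_pos (by linarith)
  have hlogxd : (Cn : ℝ) * Real.log d ≤ Real.log (x : ℝ) := by
    have := Real.log_le_log (pow_pos hdpos Cn) hx_d
    rwa [Real.log_pow] at this
  -- Li ≥ (x-2)/log x ≥ x/log x − 2
  have hLi : (x : ℝ) / Real.log (x : ℝ) - 2 ≤ offsetLogIntegral (x : ℝ) := by
    have h1 := sub_mul_inv_log_pow_le_offsetLogIntegralPow 1 hx2
    rw [offsetLogIntegralPow_one, pow_one, ← div_eq_mul_inv] at h1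
    have h2 : (x : ℝ) / Real.log (x : ℝ) - 2 ≤ ((x : ℝ) - 2) / Real.log (x : ℝ) := by
      rw [sub_div]
      have : 2 / Real.log (x : ℝ) ≤ 2 := by
        rw [div_le_iff₀ hlogpos]; nlinarith
      linarith
    linarith
  -- π(x) ≤ 2 log 4 · x/log x + √x
  have hA0 : 0 ≤ (x : ℝ) / Real.log (x : ℝ) := by positivity
  have hpi : (Nat.primeCounting x : ℝ) ≤ 2.7726 * ((x : ℝ) / Real.log (x : ℝ)) + Real.sqrt (x : ℝ) := by
    have h1 := Chebyshev.pi_le_log4_mul_div hx1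
    rw [Nat.floor_natCast] at h1
    have hlogsqrt : Real.log (Real.sqrt (x:ℝ)) = Real.log (x:ℝ) / 2 := Real.log_sqrt (by positivity)
    rw [hlogsqrt] at h1
    have e3 : Real.log 4 * (x:ℝ) / (Real.log (x:ℝ) / 2) = 2 * Real.log 4 * ((x:ℝ) / Real.log (x:ℝ)) := by
      field_simp
    rw [e3] at h1
    have hlog4 : Real.log 4 < 1.3863 := by
      have : Real.log 4 = 2 * Real.log 2 := by
        rw [show (4:ℝ) = 2 ^ 2 by norm_num, Real.log_pow]; norm_num
      rw [this]; have := Real.log_two_lt_d9; linarith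
    have h4 : 2 * Real.log 4 * ((x:ℝ) / Real.log (x:ℝ)) ≤ 2.7726 * ((x:ℝ) / Real.log (x:ℝ)) :=
      mul_le_mul_of_nonneg_right (by linarith) hA0
    linarith
  -- (A) lower prime ideal theorem at x: the nearby-zero alternative contradicts Stark
  have hlowK : 29 * offsetLogIntegral (x : ℝ) ≤ 32 * (primeIdealCount K (x : ℝ) : ℝ) := by
    rcases hC₁ (x : ℝ) hQC₁ with h | ⟨β₁, -, hβhi, hzero, hnear⟩
    · exact h
    · exfalso
      have hd_nat : (((NumberField.discr K).natAbs : ℕ) : ℝ) = d := by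
        rw [hddef, Nat.cast_natAbs, Int.cast_abs]
      have hβup : β₁ < 1 - c / Real.log d := by
        by_contra hcon
        rw [not_lt] at hcon
        exact hSc β₁ (by rw [hd_nat]; exact hcon) hβhi hzero
      have h1 : c / Real.log d < 1 - β₁ := by linarith
      have hcd : 0 ≤ c / Real.log d := div_nonneg hc.le hlogd.le
      have h3 : c / Real.log d * ((Cn : ℝ) * Real.log d) ≤ c / Real.log d * Real.log (x : ℝ) :=
        mul_le_mul_of_nonneg_left hlogxd hcd
      have h2 : c / Real.log d * ((Cn : ℝ) * Real.log d) = c * Cn := by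
        field_simp
      have h4 : 4 ≤ c * Cn := by
        have h41 : 4 ≤ c * C' := by
          have := (div_le_iff₀ hc).1 hcle; linarith
        have h42 : c * C' ≤ c * Cn := mul_le_mul_of_nonneg_left hCnC' hc.le
        linarith
      have h5 : c / Real.log d * Real.log (x : ℝ) ≤ (1 - β₁) * Real.log (x : ℝ) :=
        mul_le_mul_of_nonneg_right h1.le hlogpos.le
      linarith
  -- (B) counting: fibres, degree ≥ 2 primes
  set a : ClassGroup (𝓞 K) → ℝ := fun C => ((degOneInClass K x C).ncard : ℝ) with hadef
  set D : Set (Ideal (𝓞 K)) := {P : Ideal (𝓞 K) | P.IsPrime ∧ P ≠ ⊥ ∧ (Ideal.absNorm P).Prime ∧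
      Ideal.absNorm P ≤ x} with hD
  have hDsum : (Set.ncard D : ℝ) = ∑ C : ClassGroup (𝓞 K), a C := by
    rw [hD, ncard_degOne_eq_sum_classes K x]
    push_cast
    rfl
  have hEsum : ((escapeSet K x M).ncard : ℝ) =
      ∑ C ∈ Finset.univ.filter (fun C : ClassGroup (𝓞 K) => C ∉ M), a C := by
    rw [ncard_escapeSet_eq_sum K x M]
    push_cast
    rfl
  have hsplit : ∑ C ∈ Finset.univ.filter (fun C : ClassGroup (𝓞 K) => C ∈ M), a C +
      ∑ C ∈ Finset.univ.filter (fun C : ClassGroup (𝓞 K) => C ∉ M), a C = ∑ C, a C :=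
    Finset.sum_filter_add_sum_filter_not _ _ _
  have hDeq : Set.ncard D = ∑ p ∈ (Finset.Icc 0 x).filter Nat.Prime, normPrimeIdealCount K p :=
    ncard_degOne_eq_sum K x
  have hdeg := primeIdealCount_le_degOne_add K x
  rw [hKn, ← hDeq] at hdeg
  -- π(√x) ≤ √x + 1
  have hpisqrt : (Nat.primeCounting (Nat.sqrt x) : ℝ) ≤ Real.sqrt (x : ℝ) + 1 := by
    have h1 : Nat.primeCounting (Nat.sqrt x) ≤ Nat.sqrt x + 1 := by
      rw [Nat.primeCounting, Nat.primeCounting']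
      exact Nat.count_le _
    have h2 : ((Nat.sqrt x : ℕ) : ℝ) ≤ Real.sqrt (x : ℝ) := by
      rw [Real.le_sqrt (by positivity) (by positivity)]
      exact_mod_cast Nat.sqrt_le' x
    calc (Nat.primeCounting (Nat.sqrt x) : ℝ) ≤ (Nat.sqrt x : ℝ) + 1 := by exact_mod_cast h1
      _ ≤ Real.sqrt (x : ℝ) + 1 := by linarith
  have e1 : ((primeIdealCount K (x : ℝ) : ℕ) : ℝ) ≤
      (Set.ncard D : ℝ) + (n : ℝ) * Real.sqrt (x : ℝ) + n := by
    have h1 : ((primeIdealCount K (x:ℝ) : ℕ) : ℝ) ≤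
        ((Set.ncard D + n * Nat.primeCounting (Nat.sqrt x) : ℕ) : ℝ) := by
      exact_mod_cast hdeg
    push_cast at h1
    have hn0 : (0:ℝ) ≤ n := Nat.cast_nonneg n
    have h2 : (n:ℝ) * (Nat.primeCounting (Nat.sqrt x) : ℝ) ≤ n * (Real.sqrt (x : ℝ) + 1) :=
      mul_le_mul_of_nonneg_left hpisqrt hn0
    have h3 : (n:ℝ) * (Real.sqrt (x : ℝ) + 1) = n * Real.sqrt (x : ℝ) + n := by ring
    rw [h3] at h2
    linarith
  -- (C) the lever: m · (inside) ≤ total + (m − 1) · Li/8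
  have hidx : (2 : ℝ) ≤ M.index := by
    have h1 : M.index ≠ 1 := fun h => hM (Subgroup.index_eq_one.mp h)
    have h2 : M.index ≠ 0 := Subgroup.index_ne_zero_of_finite
    exact_mod_cast (show 2 ≤ M.index by omega)
  have horth : (M.index : ℝ) * ∑ C ∈ Finset.univ.filter (fun C : ClassGroup (𝓞 K) => C ∈ M), a C
      ≤ ∑ C, a C + ((M.index : ℝ) - 1) * (offsetLogIntegral (x : ℝ) / 8) := by
    refine index_mul_sum_filter_mem_le M a (offsetLogIntegral (x : ℝ) / 8) ?_
    intro χ hχ _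
    have h := hC₂ χ hχ (x : ℝ) hQC₂
    have h' : ∑ C : ClassGroup (𝓞 K), ((χ C : ℂ)).re * (degOneClassCount K C (x : ℝ) : ℝ)
        = ∑ C : ClassGroup (𝓞 K), ((χ C : ℂ)).re * a C := by
      refine Finset.sum_congr rfl fun C _ => ?_
      rw [hadef, degOneClassCount_natCast]
    rw [h'] at h
    linarith
  -- (D) assembly in ℝ
  have hin0 : 0 ≤ ∑ C ∈ Finset.univ.filter (fun C : ClassGroup (𝓞 K) => C ∈ M), a C :=
    Finset.sum_nonneg fun C _ => by rw [hadef]; exact Nat.cast_nonneg _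
  have hout0 : 0 ≤ ∑ C ∈ Finset.univ.filter (fun C : ClassGroup (𝓞 K) => C ∉ M), a C :=
    Finset.sum_nonneg fun C _ => by rw [hadef]; exact Nat.cast_nonneg _
  have hE : ∑ C, a C - offsetLogIntegral (x : ℝ) / 8 ≤
      2 * ∑ C ∈ Finset.univ.filter (fun C : ClassGroup (𝓞 K) => C ∉ M), a C := by
    set T := ∑ C, a C with hTdef
    set In := ∑ C ∈ Finset.univ.filter (fun C : ClassGroup (𝓞 K) => C ∈ M), a C with hIndef
    set Out := ∑ C ∈ Finset.univ.filter (fun C : ClassGroup (𝓞 K) => C ∉ M), a C with hOutdef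
    set L' := offsetLogIntegral (x : ℝ) / 8 with hL'def
    set m : ℝ := (M.index : ℝ) with hmdef
    have hIn : In = T - Out := by linarith [hsplit]
    rw [hIn] at horth
    have h1 : (m - 1) * (T - L') ≤ m * Out := by
      have e1' : m * (T - Out) = m * T - m * Out := by ring
      have e2 : (m - 1) * L' = m * L' - L' := by ring
      have e3 : (m - 1) * (T - L') = m * T - m * L' - T + L' := by ring
      rw [e1', e2] at horth
      rw [e3]
      linarith
    by_cases hT : T - L' ≤ 0
    · linarith [hout0]
    · rw [not_le] at hT
      have h2 : (m / 2) * (T - L') ≤ (m - 1) * (T - L') := by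
        apply mul_le_mul_of_nonneg_right _ hT.le
        linarith
      have h3 : m * (T - L' - 2 * Out) ≤ 0 := by
        have e4 : m * (T - L' - 2 * Out) = 2 * ((m / 2) * (T - L')) - 2 * (m * Out) := by ring
        rw [e4]
        linarith
      have hm0 : 0 < m := by linarith
      by_contra hcon
      rw [not_le] at hcon
      have : 0 < m * (T - L' - 2 * Out) := mul_pos hm0 (by linarith)
      linarith
  have hsqrt0 : 0 ≤ Real.sqrt (x : ℝ) := Real.sqrt_nonneg _
  have hn0 : (0 : ℝ) ≤ n := Nat.cast_nonneg n
  have hns0 : 0 ≤ (n : ℝ) * Real.sqrt (x : ℝ) := mul_nonneg hn0 hsqrt0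
  have hgoal : (Nat.primeCounting x : ℝ) ≤ 8 * ((escapeSet K x M).ncard : ℝ) := by
    rw [hEsum]
    linarith [hlowK, hE, e1, hDsum, hLi, hpi, hsize, hsqrt0, hn0, hns0]
  have hgoal' : Nat.primeCounting x ≤ 8 * (escapeSet K x M).ncard := by exact_mod_cast hgoal
  exact hgoal'

/-! ## §4 The `n = 3` slice from the `κ`-inputs -/

/-- **`CubicEscape` (the body of `DegreeOnePrimesEscape` at `n = 3`) from the three `κ`-inputs at
degree `3`**: R(3) — a residue lower bound `κ_K ≥ Q^{−A}` for all cubic fields; T4(3) — the one-sided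
per-character deficit for cubic fields with `κ_K ≥ Q^{−A}`; T5(3) — the lower prime ideal theorem
dichotomy for cubic fields with `κ_K ≥ Q^{−A}`. Stark's interval at `n = 3` is the tree's theorem
`stub_starkNoQuadSubfield`, the per-field composition is `escape_of_inputs`, and the counted set is
`escapeSet K x M` verbatim the crux's set. -/
theorem cubicEscape_of_kappaInputs {A : ℝ} (hA : 0 ≤ A)
    (hR : ∀ (K : Type) [Field K] [NumberField K], Module.finrank ℚ K = 3 →
      ThornerZaman.condQn K ^ (-A) ≤ NumberField.dedekindZeta_residue K)
    (hD : ∃ C₂ : ℝ, ∀ (K : Type) [Field K] [NumberField K], Module.finrank ℚ K = 3 →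
      ThornerZaman.condQn K ^ (-A) ≤ NumberField.dedekindZeta_residue K →
      ∀ χ : ClassGroup (𝓞 K) →* ℂˣ, χ ≠ 1 → ∀ x : ℝ, ThornerZaman.condQn K ^ C₂ ≤ x →
        8 * ∑ C : ClassGroup (𝓞 K), ((χ C : ℂ)).re * (degOneClassCount K C x : ℝ) ≤ offsetLogIntegral x)
    (hL : ∃ C₁ : ℝ, ∀ (K : Type) [Field K] [NumberField K], Module.finrank ℚ K = 3 →
      ThornerZaman.condQn K ^ (-A) ≤ NumberField.dedekindZeta_residue K →
      ∀ x : ℝ, ThornerZaman.condQn K ^ C₁ ≤ x →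
        29 * offsetLogIntegral x ≤ 32 * (primeIdealCount K x : ℝ) ∨
        ∃ β₁ : ℝ, 1 - 1 / (8 * Real.log (ThornerZaman.condQn K)) < β₁ ∧ β₁ < 1 ∧
          dedekindZetaCont K β₁ = 0 ∧ (1 - β₁) * Real.log x < 4) :
    ∃ C : ℕ, ∀ (K : Type) [Field K] [NumberField K], Module.finrank ℚ K = 3 →
      (∀ F : IntermediateField ℚ K, Module.finrank ℚ F ≠ 2) → ∀ x : ℕ, |NumberField.discr K| ^ C ≤ (x : ℤ) →
      ∀ M : Subgroup (ClassGroup (NumberField.RingOfIntegers K)), M ≠ ⊤ →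
        Nat.primeCounting x ≤ 8 * Set.ncard {P : Ideal (NumberField.RingOfIntegers K) | P.IsPrime ∧
          (Ideal.absNorm P).Prime ∧ Ideal.absNorm P ≤ x ∧
          ∃ hP : P ∈ nonZeroDivisors (Ideal (NumberField.RingOfIntegers K)), ClassGroup.mk0 ⟨P, hP⟩ ∉ M} := by
  classical
  have _ := hA
  obtain ⟨C₂, hC₂⟩ := hD
  obtain ⟨C₁, hC₁⟩ := hL
  obtain ⟨c, hc, hSc⟩ := stub_starkNoQuadSubfield 3
  refine ⟨(⌈max (max C₂ C₁) (max 1 (4 / c))⌉₊ + 50) * (1 + 3 ^ 2) + 3, ?_⟩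
  intro K _ _ hKn hnq x hx M hM
  have hκ := hR K hKn
  exact escape_of_inputs (le_refl 3) hc K hKn (fun χ hχ y hy => hC₂ K hKn hκ χ hχ y hy)
    (fun y hy => hC₁ K hKn hκ y hy) (fun σ h1 h2 => hSc K hKn hnq σ h1 h2) x _ rfl hx M hM

end CubicEscape

end Summit.QuantumAdvantage.QuantumAdvantage.Theorems.DegreeOnePrimesEscape

end
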